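import Literature.Probability.LatticeModels.KCSignConditionLattice
import Mathlib.Analysis.Convex.PathConnected
import HarnessLib

/-!
# Touching paths of plaquettes: planar realisation, reachable sets and exits

Topic `Literature/Probability/LatticeModels`. The combinatorial/topological glue between the
lattice inequality of the sign condition (`KCSignConditionLattice.lean`) and planar topology.
In the Kadanoff–Ceva rendering of the tree the walk on plaquettes defining the harmonic measure
with killing (`kcModHM`, `KCModifiedDirichlet.lean`) steps from a plaquette `f` to `sideNbr f j`
only across a side `j` that TOUCHES the free set `Λ` (`SideTouch Λ f j`: one of the two corners
of the side is free). We prove: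

* `plaqCentre`, `plaqClosedSq`, `IsCornerOf`, `frozenSkeleton Λ` (the union of the closed unit
  segments joining adjacent frozen sites) — the planar objects attached to the lattice;
* **`segment_centre_corner_disjoint_frozenSkeleton`** — the half-diagonal from the centre of a
  plaquette to a FREE corner avoids the frozen skeleton; hence a touching step `f → sideNbr f j`
  is realised by the polyline centre → free corner → centre, a continuous path in
  `plaqClosedSq f ∪ plaqClosedSq (sideNbr f j)` avoiding `frozenSkeleton Λ` (`exists_path_of_touchAdj`);
* `touchReachable Λ avoid f₀ g` — reachability by touching steps through plaquettes off `avoid`,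
  the finite reachable set `touchReach Λ avoid f₀ ⊆ insert f₀ (touchPlaquettes Λ)`, its closure
  under touching steps off `avoid` (`sideNbr_mem_touchReach`) and **the exit property**: a touching
  exit of `touchReach` lands in `avoid` (`mem_avoid_of_exit`) — the hypotheses `hexit`/`hclosed`/
  `hcarry` of `KCSignConditionLattice.lean` are of this form;
* **`not_touchReachable_of_separated`** — if every continuous planar path from `plaqCentre f₀` to
  `plaqCentre g` avoiding the frozen skeleton meets a set `C̄` all of whose plaquettes
  (closed squares meeting `C̄`) are avoided, then `g` is not reachable: the region `D` of the
  sign-condition argument (Chelkak–Smirnov 2012, proof of Thm. 6.1: "`D^δ ⊂ Ω^δ` the part of `Ω^δ`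
  lying inside `C`") is confined by the contour together with the frozen skeleton.

Everything is `[folklore]` planar combinatorics; no named fact.

## References

* D. Chelkak, S. Smirnov, Invent. Math. 189 (2012) = arXiv:0910.2045, proof of Thm. 6.1 (the
  region `D^δ` and its boundary `C^δ ∪ (s^δ p^δ)`) [ChelkakSmirnov2012Ising].
* D. Chelkak, C. Hongler, K. Izyurov, Ann. of Math. 181 (2015), §3.3.1 [ChelkakHonglerIzyurovAnnals2015].
-/

noncomputable section

open Set

namespace Literature.Probability.LatticeModels

open Site

/-! ### Planar objects attached to plaquettes -/

/-- The centre of the plaquette `f` (lattice units). [folklore] -/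
def plaqCentre (f : Site 2) : ℂ := ⟨(f 0 : ℝ) + 1 / 2, (f 1 : ℝ) + 1 / 2⟩

/-- The closed unit square of the plaquette `f`. [folklore] -/
def plaqClosedSq (f : Site 2) : Set ℂ :=
  {z | (f 0 : ℝ) ≤ z.re ∧ z.re ≤ (f 0 : ℝ) + 1 ∧ (f 1 : ℝ) ≤ z.im ∧ z.im ≤ (f 1 : ℝ) + 1}

/-- `c` is a corner of the plaquette `f` (coordinate form). [folklore] -/
def IsCornerOf (f c : Site 2) : Prop := (c 0 = f 0 ∨ c 0 = f 0 + 1) ∧ (c 1 = f 1 ∨ c 1 = f 1 + 1)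

/-- The corners `f + cornerOff i` are corners. [folklore] -/
theorem isCornerOf_add_cornerOff (f : Site 2) (i : Fin 4) : IsCornerOf f (f + cornerOff i) := by
  fin_cases i <;> simp [IsCornerOf, Pi.add_apply]

/-- The two corners of side `j` of `f` are corners of the plaquette across that side. [folklore] -/
theorem isCornerOf_sideNbr (f : Site 2) (j : Fin 4) :
    IsCornerOf (sideNbr f j) (f + cornerOff j) ∧ IsCornerOf (sideNbr f j) (f + cornerOff j + cornerUnit j) := by
  fin_cases j <;> simp [IsCornerOf, sideNbr, Pi.add_apply]

/-- A touching side has a free corner common to both plaquettes. [cite: ChelkakHonglerIzyurovAnnals2015, §3.3.1] -/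
theorem exists_free_corner_of_sideTouch {Λ : Finset (Site 2)} {f : Site 2} {j : Fin 4} (h : SideTouch Λ f j) :
    ∃ c ∈ Λ, IsCornerOf f c ∧ IsCornerOf (sideNbr f j) c := by
  rcases h with h | h
  · exact ⟨_, h, isCornerOf_add_cornerOff f j, (isCornerOf_sideNbr f j).1⟩
  · refine ⟨_, h, ?_, (isCornerOf_sideNbr f j).2⟩
    rw [add_right_comm, add_cornerUnit_add_cornerOff]
    exact isCornerOf_add_cornerOff f (j + 1)

/-- The centre lies in the closed square. [folklore] -/
theorem plaqCentre_mem_plaqClosedSq (f : Site 2) : plaqCentre f ∈ plaqClosedSq f := by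
  simp only [plaqClosedSq, plaqCentre, Set.mem_setOf_eq]
  refine ⟨by linarith, by linarith, by linarith, by linarith⟩

/-- A corner lies in the closed square. [folklore] -/
theorem toComplex_mem_plaqClosedSq {f c : Site 2} (h : IsCornerOf f c) : toComplex c ∈ plaqClosedSq f := by
  obtain ⟨h0, h1⟩ := h
  simp only [plaqClosedSq, toComplex_re, toComplex_im, Set.mem_setOf_eq]
  rcases h0 with h0 | h0 <;> rcases h1 with h1 | h1 <;> rw [h0, h1] <;> push_cast <;>
    refine ⟨by linarith, by linarith, by linarith, by linarith⟩

/-- Convex combinations stay between bounds. [folklore] -/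
theorem convexComb_mem_Icc {a b p q lo hi : ℝ} (ha : 0 ≤ a) (hb : 0 ≤ b) (hab : a + b = 1)
    (hp : lo ≤ p ∧ p ≤ hi) (hq : lo ≤ q ∧ q ≤ hi) : lo ≤ a * p + b * q ∧ a * p + b * q ≤ hi := by
  have h1 : 0 ≤ a * (p - lo) := mul_nonneg ha (sub_nonneg.2 hp.1)
  have h2 : 0 ≤ b * (q - lo) := mul_nonneg hb (sub_nonneg.2 hq.1)
  have h3 : 0 ≤ a * (hi - p) := mul_nonneg ha (sub_nonneg.2 hp.2)
  have h4 : 0 ≤ b * (hi - q) := mul_nonneg hb (sub_nonneg.2 hq.2)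
  have e1 : a * p + b * q - lo = a * (p - lo) + b * (q - lo) := by
    have : lo = (a + b) * lo := by rw [hab, one_mul]
    conv_lhs => rw [this]
    ring
  have e2 : hi - (a * p + b * q) = a * (hi - p) + b * (hi - q) := by
    have : hi = (a + b) * hi := by rw [hab, one_mul]
    conv_lhs => rw [this]
    ring
  constructor <;> linarith

/-- The closed square is convex. [folklore] -/
theorem convex_plaqClosedSq (f : Site 2) : Convex ℝ (plaqClosedSq f) := by
  intro x hx y hy a b ha hb hab
  simp only [plaqClosedSq, Set.mem_setOf_eq, Complex.add_re, Complex.add_im, Complex.smul_re, Complex.smul_im,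
    smul_eq_mul] at hx hy ⊢
  obtain ⟨hx1, hx2, hx3, hx4⟩ := hx
  obtain ⟨hy1, hy2, hy3, hy4⟩ := hy
  have hre := convexComb_mem_Icc ha hb hab ⟨hx1, hx2⟩ ⟨hy1, hy2⟩
  have him := convexComb_mem_Icc ha hb hab ⟨hx3, hx4⟩ ⟨hy3, hy4⟩
  exact ⟨hre.1, hre.2, him.1, him.2⟩

/-- The half-diagonal from the centre to a corner lies in the closed square. [folklore] -/
theorem segment_centre_corner_subset {f c : Site 2} (h : IsCornerOf f c) :
    segment ℝ (plaqCentre f) (toComplex c) ⊆ plaqClosedSq f :=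
  (convex_plaqClosedSq f).segment_subset (plaqCentre_mem_plaqClosedSq f) (toComplex_mem_plaqClosedSq h)

/-- Interior points of the half-diagonal have no integer coordinate: they lie in the open square. [folklore] -/
theorem re_im_mem_Ioo_of_mem_segment {f c : Site 2} (h : IsCornerOf f c) {z : ℂ}
    (hz : z ∈ segment ℝ (plaqCentre f) (toComplex c)) (hzc : z ≠ toComplex c) :
    ((f 0 : ℝ) < z.re ∧ z.re < (f 0 : ℝ) + 1) ∧ ((f 1 : ℝ) < z.im ∧ z.im < (f 1 : ℝ) + 1) := by
  rw [segment_eq_image'] at hz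
  obtain ⟨θ, ⟨hθ0, hθ1⟩, rfl⟩ := hz
  have hθ : θ < 1 := by
    rcases eq_or_lt_of_le hθ1 with rfl | hlt
    · exact absurd (by simp) hzc
    · exact hlt
  obtain ⟨h0, h1⟩ := h
  simp only [Complex.add_re, Complex.add_im, Complex.smul_re, Complex.smul_im, Complex.sub_re, Complex.sub_im,
    smul_eq_mul, plaqCentre, toComplex_re, toComplex_im]
  constructor
  · rcases h0 with h0 | h0 <;> rw [h0] <;> push_cast <;> constructor <;> nlinarith
  · rcases h1 with h1 | h1 <;> rw [h1] <;> push_cast <;> constructor <;> nlinarith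

/-! ### The frozen skeleton -/

/-- **The frozen skeleton** of the free set `Λ`: the union of the closed unit segments joining two
adjacent frozen (non-free) sites. Touching steps never cross it. [cite: ChelkakHonglerIzyurovAnnals2015, §3.3.1] -/
def frozenSkeleton (Λ : Finset (Site 2)) : Set ℂ :=
  ⋃ (a : Site 2) (k : Fin 4) (_ : a ∉ Λ ∧ a + cornerUnit k ∉ Λ), segment ℝ (toComplex a) (toComplex (a + cornerUnit k))

/-- Membership in the frozen skeleton. [folklore] -/
theorem mem_frozenSkeleton_iff {Λ : Finset (Site 2)} {w : ℂ} :
    w ∈ frozenSkeleton Λ ↔ ∃ (a : Site 2) (k : Fin 4), (a ∉ Λ ∧ a + cornerUnit k ∉ Λ) ∧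
      w ∈ segment ℝ (toComplex a) (toComplex (a + cornerUnit k)) := by
  simp only [frozenSkeleton, Set.mem_iUnion, exists_prop]

/-- Points of the frozen skeleton have an integer coordinate. [folklore] -/
theorem exists_int_coord_of_mem_frozenSkeleton {Λ : Finset (Site 2)} {w : ℂ} (hw : w ∈ frozenSkeleton Λ) :
    (∃ n : ℤ, w.re = n) ∨ (∃ n : ℤ, w.im = n) := by
  obtain ⟨a, k, -, hw⟩ := mem_frozenSkeleton_iff.1 hw
  rw [segment_eq_image'] at hw
  obtain ⟨θ, -, rfl⟩ := hw
  fin_cases k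
  · right; exact ⟨a 1, by simp [Pi.add_apply]⟩
  · left; exact ⟨a 0, by simp [Pi.add_apply]⟩
  · right; exact ⟨a 1, by simp [Pi.add_apply]⟩
  · left; exact ⟨a 0, by simp [Pi.add_apply]⟩

/-- A site on the frozen skeleton is frozen. [folklore] -/
theorem not_mem_of_toComplex_mem_frozenSkeleton {Λ : Finset (Site 2)} {v : Site 2}
    (hv : toComplex v ∈ frozenSkeleton Λ) : v ∉ Λ := by
  obtain ⟨a, k, ⟨ha, hak⟩, hw⟩ := mem_frozenSkeleton_iff.1 hv
  rw [segment_eq_image'] at hw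
  obtain ⟨θ, ⟨hθ0, hθ1⟩, hθ⟩ := hw
  have hre := congrArg Complex.re hθ
  have him := congrArg Complex.im hθ
  simp only [Complex.add_re, Complex.add_im, Complex.smul_re, Complex.smul_im, Complex.sub_re, Complex.sub_im,
    smul_eq_mul, toComplex_re, toComplex_im, Pi.add_apply, Int.cast_add] at hre him
  -- `θ` is an integer in `[0, 1]`, hence `0` or `1`, and `v ∈ {a, a + e_k}`
  have key : v = a ∨ v = a + cornerUnit k := by
    fin_cases k <;> simp at hre him
    · -- `k = 0`: `v 0 = a 0 + θ`, `v 1 = a 1`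
      have hθint : (((v 0 - a 0 : ℤ)) : ℝ) = θ := by push_cast; linarith
      have h01 : v 0 - a 0 = 0 ∨ v 0 - a 0 = 1 := by
        have h0' : (0 : ℝ) ≤ ((v 0 - a 0 : ℤ) : ℝ) := by rw [hθint]; exact hθ0
        have h1' : ((v 0 - a 0 : ℤ) : ℝ) ≤ 1 := by rw [hθint]; exact hθ1
        have h0'' : (0 : ℤ) ≤ v 0 - a 0 := by exact_mod_cast h0'
        have h1'' : v 0 - a 0 ≤ 1 := by exact_mod_cast h1'
        omega
      have him' : v 1 = a 1 := by exact_mod_cast him.symm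
      rcases h01 with h | h
      · left; ext i; fin_cases i <;> simp <;> omega
      · right; ext i; fin_cases i <;> simp [Pi.add_apply] <;> omega
    · -- `k = 1`: `v 0 = a 0`, `v 1 = a 1 + θ`
      have hθint : (((v 1 - a 1 : ℤ)) : ℝ) = θ := by push_cast; linarith
      have h01 : v 1 - a 1 = 0 ∨ v 1 - a 1 = 1 := by
        have h0' : (0 : ℝ) ≤ ((v 1 - a 1 : ℤ) : ℝ) := by rw [hθint]; exact hθ0
        have h1' : ((v 1 - a 1 : ℤ) : ℝ) ≤ 1 := by rw [hθint]; exact hθ1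
        have h0'' : (0 : ℤ) ≤ v 1 - a 1 := by exact_mod_cast h0'
        have h1'' : v 1 - a 1 ≤ 1 := by exact_mod_cast h1'
        omega
      have hre' : v 0 = a 0 := by exact_mod_cast hre.symm
      rcases h01 with h | h
      · left; ext i; fin_cases i <;> simp <;> omega
      · right; ext i; fin_cases i <;> simp [Pi.add_apply] <;> omega
    · -- `k = 2`: `v 0 = a 0 - θ`, `v 1 = a 1`
      have hθint : (((a 0 - v 0 : ℤ)) : ℝ) = θ := by push_cast; linarith
      have h01 : a 0 - v 0 = 0 ∨ a 0 - v 0 = 1 := by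
        have h0' : (0 : ℝ) ≤ ((a 0 - v 0 : ℤ) : ℝ) := by rw [hθint]; exact hθ0
        have h1' : ((a 0 - v 0 : ℤ) : ℝ) ≤ 1 := by rw [hθint]; exact hθ1
        have h0'' : (0 : ℤ) ≤ a 0 - v 0 := by exact_mod_cast h0'
        have h1'' : a 0 - v 0 ≤ 1 := by exact_mod_cast h1'
        omega
      have him' : v 1 = a 1 := by exact_mod_cast him.symm
      rcases h01 with h | h
      · left; ext i; fin_cases i <;> simp <;> omega
      · right; ext i; fin_cases i <;> simp [Pi.add_apply] <;> omega
    · -- `k = 3`: `v 0 = a 0`, `v 1 = a 1 - θ`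
      have hθint : (((a 1 - v 1 : ℤ)) : ℝ) = θ := by push_cast; linarith
      have h01 : a 1 - v 1 = 0 ∨ a 1 - v 1 = 1 := by
        have h0' : (0 : ℝ) ≤ ((a 1 - v 1 : ℤ) : ℝ) := by rw [hθint]; exact hθ0
        have h1' : ((a 1 - v 1 : ℤ) : ℝ) ≤ 1 := by rw [hθint]; exact hθ1
        have h0'' : (0 : ℤ) ≤ a 1 - v 1 := by exact_mod_cast h0'
        have h1'' : a 1 - v 1 ≤ 1 := by exact_mod_cast h1'
        omega
      have hre' : v 0 = a 0 := by exact_mod_cast hre.symm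
      rcases h01 with h | h
      · left; ext i; fin_cases i <;> simp <;> omega
      · right; ext i; fin_cases i <;> simp [Pi.add_apply] <;> omega
  rcases key with rfl | rfl
  · exact ha
  · exact hak

/-- **The half-diagonal from the centre of a plaquette to a free corner avoids the frozen
skeleton.** [cite: ChelkakHonglerIzyurovAnnals2015, §3.3.1] -/
theorem segment_centre_corner_disjoint_frozenSkeleton {Λ : Finset (Site 2)} {f c : Site 2} (h : IsCornerOf f c)
    (hc : c ∈ Λ) {z : ℂ} (hz : z ∈ segment ℝ (plaqCentre f) (toComplex c)) : z ∉ frozenSkeleton Λ := by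
  intro hzS
  by_cases hzc : z = toComplex c
  · rw [hzc] at hzS
    exact not_mem_of_toComplex_mem_frozenSkeleton hzS hc
  · obtain ⟨⟨h1, h2⟩, ⟨h3, h4⟩⟩ := re_im_mem_Ioo_of_mem_segment h hz hzc
    rcases exists_int_coord_of_mem_frozenSkeleton hzS with ⟨n, hn⟩ | ⟨n, hn⟩
    · rw [hn] at h1 h2
      have h1' : f 0 < n := by exact_mod_cast h1
      have h2' : n < f 0 + 1 := by exact_mod_cast h2
      omega
    · rw [hn] at h3 h4
      have h3' : f 1 < n := by exact_mod_cast h3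
      have h4' : n < f 1 + 1 := by exact_mod_cast h4
      omega

/-! ### Touching steps and their planar realisation -/

/-- `g` is the plaquette across a touching side of `f`. [cite: ChelkakHonglerIzyurovAnnals2015, §3.3.1] -/
def TouchAdj (Λ : Finset (Site 2)) (f g : Site 2) : Prop := ∃ j : Fin 4, SideTouch Λ f j ∧ g = sideNbr f j

/-- Touching adjacency is symmetric. [folklore] -/
theorem TouchAdj.symm {Λ : Finset (Site 2)} {f g : Site 2} (h : TouchAdj Λ f g) : TouchAdj Λ g f := by
  obtain ⟨j, hj, rfl⟩ := h
  exact ⟨j + 2, (sideTouch_sideNbr Λ f j).2 hj, (sideNbr_sideNbr f j).symm⟩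

/-- **Planar realisation of a touching step**: a continuous path from `plaqCentre f` to
`plaqCentre g` inside `plaqClosedSq f ∪ plaqClosedSq g` avoiding the frozen skeleton (the polyline
through the free corner). [cite: ChelkakHonglerIzyurovAnnals2015, §3.3.1] -/
theorem exists_path_of_touchAdj {Λ : Finset (Site 2)} {f g : Site 2} (h : TouchAdj Λ f g) :
    ∃ γ : Path (plaqCentre f) (plaqCentre g), ∀ t, γ t ∉ frozenSkeleton Λ ∧ (γ t ∈ plaqClosedSq f ∨ γ t ∈ plaqClosedSq g) := by
  obtain ⟨j, hj, rfl⟩ := h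
  obtain ⟨c, hc, hcf, hcg⟩ := exists_free_corner_of_sideTouch hj
  refine ⟨(Path.segment (plaqCentre f) (toComplex c)).trans (Path.segment (toComplex c) (plaqCentre (sideNbr f j))), fun t => ?_⟩
  have ht : ((Path.segment (plaqCentre f) (toComplex c)).trans (Path.segment (toComplex c) (plaqCentre (sideNbr f j)))) t ∈
      segment ℝ (plaqCentre f) (toComplex c) ∪ segment ℝ (toComplex c) (plaqCentre (sideNbr f j)) := by
    have := Set.mem_range_self (f := (Path.segment (plaqCentre f) (toComplex c)).trans
      (Path.segment (toComplex c) (plaqCentre (sideNbr f j)))) t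
    rwa [Path.trans_range, Path.range_segment, Path.range_segment] at this
  rcases ht with ht | ht
  · exact ⟨segment_centre_corner_disjoint_frozenSkeleton hcf hc ht, Or.inl (segment_centre_corner_subset hcf ht)⟩
  · rw [segment_symm] at ht
    exact ⟨segment_centre_corner_disjoint_frozenSkeleton hcg hc ht, Or.inr (segment_centre_corner_subset hcg ht)⟩

/-! ### Reachability by touching steps off a set -/

/-- **Reachability by touching steps through plaquettes off `avoid`.** [cite: ChelkakSmirnov2012Ising, proof of Thm. 6.1 (the region D^δ)] -/
def touchReachable (Λ : Finset (Site 2)) (avoid : Set (Site 2)) : Site 2 → Site 2 → Prop :=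
  Relation.ReflTransGen fun f g => TouchAdj Λ f g ∧ f ∉ avoid ∧ g ∉ avoid

/-- Reachable plaquettes other than the start touch `Λ`. [folklore] -/
theorem mem_touchPlaquettes_of_touchReachable {Λ : Finset (Site 2)} {avoid : Set (Site 2)} {f₀ g : Site 2}
    (h : touchReachable Λ avoid f₀ g) : g = f₀ ∨ g ∈ touchPlaquettes Λ := by
  induction h with
  | refl => exact Or.inl rfl
  | tail _ hstep _ =>
    right
    obtain ⟨⟨j, hj, rfl⟩, -, -⟩ := hstep
    obtain ⟨c, hc, -, ⟨h0, h1⟩⟩ := exists_free_corner_of_sideTouch hj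
    rw [mem_touchPlaquettes_iff_corner]
    -- the free corner `c` of the target is one of its four `cornerOff` corners
    rcases h0 with h0 | h0 <;> rcases h1 with h1 | h1
    · refine ⟨0, ?_⟩; convert hc using 1; ext i; fin_cases i <;> simp [Pi.add_apply] <;> omega
    · refine ⟨3, ?_⟩; convert hc using 1; ext i; fin_cases i <;> simp [Pi.add_apply] <;> omega
    · refine ⟨1, ?_⟩; convert hc using 1; ext i; fin_cases i <;> simp [Pi.add_apply] <;> omega
    · refine ⟨2, ?_⟩; convert hc using 1; ext i; fin_cases i <;> simp [Pi.add_apply] <;> omega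

/-- Reachable plaquettes are off `avoid` (if the start is). [folklore] -/
theorem not_mem_avoid_of_touchReachable {Λ : Finset (Site 2)} {avoid : Set (Site 2)} {f₀ g : Site 2}
    (h₀ : f₀ ∉ avoid) (h : touchReachable Λ avoid f₀ g) : g ∉ avoid := by
  induction h with
  | refl => exact h₀
  | tail _ hstep _ => exact hstep.2.2

open scoped Classical in
/-- **The reachable set** as a `Finset` (it lies in `insert f₀ (touchPlaquettes Λ)`). [cite: ChelkakSmirnov2012Ising, proof of Thm. 6.1 (the region D^δ)] -/
def touchReach (Λ : Finset (Site 2)) (avoid : Set (Site 2)) (f₀ : Site 2) : Finset (Site 2) :=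
  (insert f₀ (touchPlaquettes Λ)).filter (touchReachable Λ avoid f₀)

/-- Membership in the reachable set. [folklore] -/
theorem mem_touchReach_iff {Λ : Finset (Site 2)} {avoid : Set (Site 2)} {f₀ g : Site 2} :
    g ∈ touchReach Λ avoid f₀ ↔ touchReachable Λ avoid f₀ g := by
  classical
  rw [touchReach, Finset.mem_filter, Finset.mem_insert]
  exact ⟨fun h => h.2, fun h => ⟨mem_touchPlaquettes_of_touchReachable h, h⟩⟩

/-- The start is reachable. [folklore] -/
theorem self_mem_touchReach (Λ : Finset (Site 2)) (avoid : Set (Site 2)) (f₀ : Site 2) : f₀ ∈ touchReach Λ avoid f₀ :=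
  mem_touchReach_iff.2 Relation.ReflTransGen.refl

/-- **Closure under touching steps off `avoid`.** [folklore] -/
theorem sideNbr_mem_touchReach {Λ : Finset (Site 2)} {avoid : Set (Site 2)} {f₀ f : Site 2} (h₀ : f₀ ∉ avoid)
    (hf : f ∈ touchReach Λ avoid f₀) {j : Fin 4} (hj : SideTouch Λ f j) (hn : sideNbr f j ∉ avoid) :
    sideNbr f j ∈ touchReach Λ avoid f₀ := by
  rw [mem_touchReach_iff] at hf ⊢
  exact hf.tail ⟨⟨j, hj, rfl⟩, not_mem_avoid_of_touchReachable h₀ hf, hn⟩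

/-- **The exit property**: a touching exit of the reachable set lands in `avoid`. [cite: ChelkakSmirnov2012Ising, proof of Thm. 6.1 (C^δ = ∂D^δ ∖ (s^δ p^δ))] -/
theorem mem_avoid_of_exit {Λ : Finset (Site 2)} {avoid : Set (Site 2)} {f₀ f : Site 2} (h₀ : f₀ ∉ avoid)
    (hf : f ∈ touchReach Λ avoid f₀) {j : Fin 4} (hj : SideTouch Λ f j) (hn : sideNbr f j ∉ touchReach Λ avoid f₀) :
    sideNbr f j ∈ avoid := by
  by_contra h
  exact hn (sideNbr_mem_touchReach h₀ hf hj h)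

/-- Closure in the `v + e_m` form used by `seed_lower_bound`. [folklore] -/
theorem add_cornerUnit_mem_touchReach {Λ : Finset (Site 2)} {avoid : Set (Site 2)} {f₀ v : Site 2} (h₀ : f₀ ∉ avoid)
    (hv : v ∈ touchReach Λ avoid f₀) (m : Fin 4) (hall : ∀ j : Fin 4, SideTouch Λ v j) (hn : v + cornerUnit m ∉ avoid) :
    v + cornerUnit m ∈ touchReach Λ avoid f₀ := by
  have e : v + cornerUnit m = sideNbr v (m + 1) := by rw [sideNbr, fin4_add_one_add_three]
  rw [e] at hn ⊢
  exact sideNbr_mem_touchReach h₀ hv (hall _) hn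

/-! ### Confinement by a separating set -/

/-- **Planar realisation of touching paths.** If `g` is reachable from `f₀` by touching steps off
`avoid`, there is a continuous planar path from `plaqCentre f₀` to `plaqCentre g` avoiding the
frozen skeleton, each point of which lies in the closed square of a plaquette off `avoid`
(reachable from `f₀`). [cite: ChelkakSmirnov2012Ising, proof of Thm. 6.1 (the region D^δ)] -/
theorem exists_path_of_touchReachable {Λ : Finset (Site 2)} {avoid : Set (Site 2)} {f₀ g : Site 2} (h₀ : f₀ ∉ avoid)
    (h : touchReachable Λ avoid f₀ g) :
    ∃ γ : Path (plaqCentre f₀) (plaqCentre g), ∀ t, γ t ∉ frozenSkeleton Λ ∧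
      ∃ f, touchReachable Λ avoid f₀ f ∧ f ∉ avoid ∧ γ t ∈ plaqClosedSq f := by
  induction h with
  | refl =>
    exact ⟨Path.refl _, fun t => ⟨by
      intro hS
      rcases exists_int_coord_of_mem_frozenSkeleton hS with ⟨n, hn⟩ | ⟨n, hn⟩
      · have hn' : (f₀ 0 : ℝ) + 1 / 2 = n := hn
        have : (2 : ℝ) * f₀ 0 + 1 = 2 * n := by linarith
        have : 2 * f₀ 0 + 1 = 2 * n := by exact_mod_cast this
        omega
      · have hn' : (f₀ 1 : ℝ) + 1 / 2 = n := hn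
        have : (2 : ℝ) * f₀ 1 + 1 = 2 * n := by linarith
        have : 2 * f₀ 1 + 1 = 2 * n := by exact_mod_cast this
        omega, f₀, Relation.ReflTransGen.refl, h₀, by simpa using plaqCentre_mem_plaqClosedSq f₀⟩⟩
  | tail hfg hstep ih =>
    rename_i f g'
    obtain ⟨γ₁, hγ₁⟩ := ih
    obtain ⟨γ₂, hγ₂⟩ := exists_path_of_touchAdj hstep.1
    refine ⟨γ₁.trans γ₂, fun t => ?_⟩
    rw [Path.trans_apply]
    split_ifs with ht
    · exact hγ₁ _
    · obtain ⟨hS, hsq⟩ := hγ₂ ⟨2 * (t : ℝ) - 1, _⟩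
      refine ⟨hS, ?_⟩
      rcases hsq with hsq | hsq
      · exact ⟨f, hfg, hstep.2.1, hsq⟩
      · exact ⟨g', hfg.tail hstep, hstep.2.2, hsq⟩

/-- **Confinement of the reachable set by a separating set.** Let `C̄ ⊆ ℂ` be such that every
plaquette whose closed square meets `C̄` is avoided, and suppose every continuous planar path from
`plaqCentre f₀` to `plaqCentre g` avoiding the frozen skeleton of `Λ` meets `C̄`. Then `g` is not
reachable from `f₀` by touching steps off `avoid`: the region of the sign-condition argument stays
on its side of the contour. [cite: ChelkakSmirnov2012Ising, proof of Thm. 6.1 (D^δ, C^δ)] -/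
theorem not_touchReachable_of_separated {Λ : Finset (Site 2)} {avoid : Set (Site 2)} {f₀ g : Site 2} (h₀ : f₀ ∉ avoid)
    (Cbar : Set ℂ) (havoid : ∀ f, (plaqClosedSq f ∩ Cbar).Nonempty → f ∈ avoid)
    (hsep : ∀ γ : Path (plaqCentre f₀) (plaqCentre g), (∀ t, γ t ∉ frozenSkeleton Λ) → ∃ t, γ t ∈ Cbar) :
    ¬ touchReachable Λ avoid f₀ g := by
  intro h
  obtain ⟨γ, hγ⟩ := exists_path_of_touchReachable h₀ h
  obtain ⟨t, ht⟩ := hsep γ fun t => (hγ t).1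
  obtain ⟨-, f, -, hfa, hft⟩ := hγ t
  exact hfa (havoid f ⟨γ t, hft, ht⟩)

/-- The `Finset` form of the confinement. [cite: ChelkakSmirnov2012Ising, proof of Thm. 6.1 (D^δ, C^δ)] -/
theorem not_mem_touchReach_of_separated {Λ : Finset (Site 2)} {avoid : Set (Site 2)} {f₀ g : Site 2} (h₀ : f₀ ∉ avoid)
    (Cbar : Set ℂ) (havoid : ∀ f, (plaqClosedSq f ∩ Cbar).Nonempty → f ∈ avoid)
    (hsep : ∀ γ : Path (plaqCentre f₀) (plaqCentre g), (∀ t, γ t ∉ frozenSkeleton Λ) → ∃ t, γ t ∈ Cbar) :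
    g ∉ touchReach Λ avoid f₀ := fun h =>
  not_touchReachable_of_separated h₀ Cbar havoid hsep (mem_touchReach_iff.1 h)

end Literature.Probability.LatticeModels
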